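import Summits.AtomisticToContinuum.Crystallization.Theses.GappedShellCensus

/-!
# `FiveFoldRationingR` (stmt-AtomisticToContinuum-18071), negative side: the one-shell local alphabet
# lemmas of the intended proof FAIL at tolerance `13/500` resp. `3/100`

Every line on the crux (cards single-shell-octet-lock, straight-tube-petrunin, horofunction-…, the
lead's skeleton `Lines/Sketch.lean` and its memo) runs through a ONE-SHELL LOCAL ALPHABET at the crux's
tolerance `1/50`: at a gapped-twelve site `y` of a torn-free configuration, (NB) at most two bonds of `y`
are capped (`≥ 5` common neighbours; "NoBranching", `n₅(y) ∈ {0, 2}`), and (CS) the five common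
neighbours of a capped bond form a CLOSED five-ring (corner word `T⁵`, ring word (5,0), positive
curvature `ω₅`) — never the open `4T+Q` star (ring word (4,1), NEGATIVE curvature).  Both are then fed to
comparison geometry (CBB(0)).  This file records, kernel-checked, how little room these two lemmas have
in the tolerance: with the hypotheses asked exactly as in the crux (pairwise band-or-gap on all of `Y`,
exactly twelve at `y`, every bond at `y` torn-free) —

* `noBranchingOneShellAt_false` : (NB) is FALSE at tolerance `13/500 = 2.6 %`: the regular icosahedral
  13-cluster (edge/circumradius `= 1/sin 72° = 1.05146…`) is gapped-twelve at its centre as soon as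
  `(1+τ)/(1−τ) ≥ 1.05146`, i.e. from `τ* = 0.025086…` on, and then ALL TWELVE bonds of the centre are
  capped (closed five-rings, `n₅ = 12`);
* `closedStarOneShellAt_false` : (CS) is FALSE at tolerance `3/100`: a torn-free gapped twelve-shell with
  TWO ADJACENT capped bonds (`64°` apart, not antipodal) whose stars are both OPEN (`4T+Q`, one ring pair
  at `≥ 1.26`) — the commonest non-T/O shell of the seat's census at `3 %` (kit j022307: 185 of 424
  feasible shells; integerised here with slack `1.5e-3`); by continuation it survives down to
  `τ ≈ 2.75 %` and no `4T+Q` shell exists at `2.5 %` (kit j022308: 0 of 7 867 restarts, best residual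
  `3.5e-5`) nor at `1/50` (j022055: best residual `9.3e-4`).

So at `1/50` the local alphabet is protected by a margin of only `≈ 0.5 %` of tolerance (icosahedral
onset `2.5086 %`, open-star onset `≈ 2.7 %`, non-antipodal pole pairs `≈ 2.6 %`); any certificate of
(NB)/(CS) at `1/50` must be metric (interval arithmetic), not topological, and cannot be expected to
survive a relaxation of the crux's constant beyond `≈ 1/40`.  (The crux itself is not refuted at any
tolerance here: that needs an infinite all-gapped configuration; see the seat's `Cruxes/…/Disproof.lean`
§ (d) for the periodic searches.)

Negative-side support for the crux (no route item is concluded positively; the two `def`s are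
hypothesis-analysis predicates — localised proof steps parametrised by the tolerance — not literature
facts); refuter seat refuter-cdisprove-stmt-AtomisticToContinuum-18071-0, 2026-08-17.
-/

noncomputable section

namespace Summit.AtomisticToContinuum.Crystallization.Theorems.FiveFoldRationingR.Negative

open Literature.Geometry.DiscreteGeometry

/-- (NB) ONE SHELL DEEP AT TOLERANCE `τ`: if all pairs of `Y` are in the band `[a(1−τ), a(1+τ)]` or beyond
the gap `63a/50`, `y ∈ Y` has exactly twelve sites within `a(1+τ)` and every bond at `y` has `≥ 4` common
neighbours, then at most two bonds at `y` are capped (`≥ 5` common neighbours).  At `τ = 1/50` this is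
the intended lemma "n₅(y) ∈ {0,2}" of every proof line; a localised proof step for hypothesis analysis
(Negative/ lane), not a literature fact. -/
def NoBranchingOneShellAt (τ : ℝ) : Prop :=
  ∀ (Y : Set (EuclideanSpace ℝ (Fin 3))) (a : ℝ), 0 < a →
    (∀ p ∈ Y, ∀ q ∈ Y, q ≠ p → a * (1 - τ) ≤ dist p q ∧
      (dist p q ≤ a * (1 + τ) ∨ a * (63 / 50) ≤ dist p q)) →
    ∀ y ∈ Y, {w ∈ Y | w ≠ y ∧ dist y w ≤ a * (1 + τ)}.ncard = 12 →
      (∀ v ∈ Y, v ≠ y → dist y v ≤ a * (1 + τ) →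
        4 ≤ {w ∈ Y | w ≠ y ∧ w ≠ v ∧ dist y w ≤ a * (1 + τ) ∧ dist v w ≤ a * (1 + τ)}.ncard) →
      {v ∈ Y | v ≠ y ∧ dist y v ≤ a * (1 + τ) ∧
        5 ≤ {w ∈ Y | w ≠ y ∧ w ≠ v ∧ dist y w ≤ a * (1 + τ) ∧
          dist v w ≤ a * (1 + τ)}.ncard}.ncard ≤ 2

/-- (CS) ONE SHELL DEEP AT TOLERANCE `τ`: under the same hypotheses at `y`, the common-neighbour ring of
every CAPPED bond `(y, v)` is closed — every common neighbour `w` of `(y, v)` is bonded to at least two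
other common neighbours (corner word `T⁵`, ring word (5,0)).  At `τ = 1/50` this is the intended lemma
"capped ⇒ closed five-ring" (the twelve-shell version of `CappedRingClosed`, Negative/OpenStar.lean); a
localised proof step for hypothesis analysis (Negative/ lane), not a literature fact. -/
def ClosedStarOneShellAt (τ : ℝ) : Prop :=
  ∀ (Y : Set (EuclideanSpace ℝ (Fin 3))) (a : ℝ), 0 < a →
    (∀ p ∈ Y, ∀ q ∈ Y, q ≠ p → a * (1 - τ) ≤ dist p q ∧
      (dist p q ≤ a * (1 + τ) ∨ a * (63 / 50) ≤ dist p q)) →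
    ∀ y ∈ Y, {w ∈ Y | w ≠ y ∧ dist y w ≤ a * (1 + τ)}.ncard = 12 →
      (∀ v ∈ Y, v ≠ y → dist y v ≤ a * (1 + τ) →
        4 ≤ {w ∈ Y | w ≠ y ∧ w ≠ v ∧ dist y w ≤ a * (1 + τ) ∧ dist v w ≤ a * (1 + τ)}.ncard) →
      ∀ v ∈ Y, v ≠ y → dist y v ≤ a * (1 + τ) →
        5 ≤ {w ∈ Y | w ≠ y ∧ w ≠ v ∧ dist y w ≤ a * (1 + τ) ∧ dist v w ≤ a * (1 + τ)}.ncard →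
        ∀ w ∈ Y, w ≠ y → w ≠ v → dist y w ≤ a * (1 + τ) → dist v w ≤ a * (1 + τ) →
          2 ≤ {w' ∈ Y | w' ≠ y ∧ w' ≠ v ∧ w' ≠ w ∧ dist y w' ≤ a * (1 + τ) ∧
            dist v w' ≤ a * (1 + τ) ∧ dist w w' ≤ a * (1 + τ)}.ncard

/-- Integer model (units of `10⁻⁴ a`) of the regular icosahedral 13-cluster: `0` = centre `y`, `1 … 12` =
`(0, ±s, ±t), (±s, ±t, 0), (±t, 0, ±s)` with `s = 5125`, `t = 8292 ≈ φ s`: radius `9748`, edges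
`10250 / 10249.5`, second distances `16584` (seat computation; not a literature fact). -/
def IcoThirteen : Fin 13 → Fin 3 → ℤ :=
  ![![0, 0, 0], ![0, 5125, 8292], ![0, 5125, -8292], ![0, -5125, 8292], ![0, -5125, -8292],
    ![5125, 8292, 0], ![5125, -8292, 0], ![-5125, 8292, 0], ![-5125, -8292, 0], ![8292, 0, 5125],
    ![-8292, 0, 5125], ![8292, 0, -5125], ![-8292, 0, -5125]]

/-- Integer model (units of `10⁻⁴ a`) of the OPEN-PAIR SHELL at `3 %`: `0` = centre `y` (twelve neighbours,
shell degrees `5,4,4,4,5,4,…,4`), `1` and `5` the two capped poles (bonded to each other), `2` a common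
neighbour of `(0,1)` bonded to only ONE other common neighbour (`4`); all `78` pairs in
`[0.9714, 1.0286] ∪ [1.2615, ∞)` (kit j022307 witness, polished and rounded by the seat; not a literature
fact). -/
def OpenPairShell : Fin 13 → Fin 3 → ℤ :=
  ![![0, 0, 0], ![-3337, 7383, 5361], ![2481, 8907, -2983], ![571, -53, 10269],
    ![6723, 5281, 4970], ![-7725, -1917, 5570], ![303, -8334, 5196], ![-2958, 2767, -9188],
    ![6298, 432, -7385], ![-7411, -5036, -4225], ![8802, -4125, 1364], ![2243, -8528, -4850],
    ![-9171, 4212, -1829]]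

/-- **(NB) fails at `13/500`.** In `Y = IcoThirteen / 10⁴` (scale `a = 1`, tolerance `13/500`) all pairs
are in `[487/500, 513/500] ∪ [63/50, ∞)`, the centre has exactly twelve neighbours, and EVERY one of its
twelve bonds has exactly five common neighbours (so torn-freeness at the centre holds and the capped
count is `12 > 2`).  Exact onset: `(1+τ)/(1−τ) = 1/sin(2π/5)`, `τ* = 0.0250862…`; the crux's `1/50` is
below it by `0.51 %`. [folklore] -/
theorem noBranchingOneShellAt_false : ¬ NoBranchingOneShellAt (13 / 500) := by
  intro h
  obtain ⟨T, hinj, hsep, htw, htf, hcap⟩ :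
      ∃ T : Fin 13 → Fin 3 → ℤ,
        (∀ i j : Fin 13, sqNormInt (T i - T j) = 0 → i = j) ∧
        (∀ i j : Fin 13, j ≠ i → 94867600 ≤ sqNormInt (T i - T j) ∧
            (sqNormInt (T i - T j) ≤ 105267600 ∨ 158760000 ≤ sqNormInt (T i - T j))) ∧
        (Finset.univ.filter fun j : Fin 13 => j ≠ 0 ∧ sqNormInt (T 0 - T j) ≤ 105267600).card = 12 ∧
        (∀ v : Fin 13, v ≠ 0 → sqNormInt (T 0 - T v) ≤ 105267600 →
          4 ≤ (Finset.univ.filter fun w : Fin 13 =>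
            w ≠ 0 ∧ w ≠ v ∧ sqNormInt (T 0 - T w) ≤ 105267600 ∧
              sqNormInt (T v - T w) ≤ 105267600).card) ∧
        (Finset.univ.filter fun v : Fin 13 => v ≠ 0 ∧ sqNormInt (T 0 - T v) ≤ 105267600 ∧
          5 ≤ (Finset.univ.filter fun w : Fin 13 =>
            w ≠ 0 ∧ w ≠ v ∧ sqNormInt (T 0 - T w) ≤ 105267600 ∧
              sqNormInt (T v - T w) ≤ 105267600).card).card = 12 :=
    ⟨IcoThirteen, by decide, by decide, by decide, by decide, by decide⟩
  obtain ⟨pt, hpt⟩ : ∃ pt : Fin 13 → EuclideanSpace ℝ (Fin 3),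
      ∀ i, pt i = (10000 : ℝ)⁻¹ • intVec (T i) := ⟨_, fun _ => rfl⟩
  have hnn : ∀ v : Fin 3 → ℤ, (0 : ℝ) ≤ (sqNormInt v : ℝ) := by
    intro v
    have h : (0 : ℤ) ≤ sqNormInt v := by unfold sqNormInt; positivity
    exact_mod_cast h
  have hdist : ∀ i j, dist (pt i) (pt j) = (10000 : ℝ)⁻¹ * Real.sqrt (sqNormInt (T i - T j) : ℝ) := by
    intro i j
    rw [hpt, hpt, dist_eq_norm, ← smul_sub, intVec_sub, norm_smul, norm_inv,
      Real.norm_of_nonneg (by norm_num : (0 : ℝ) ≤ 10000), norm_intVec]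
  have hle : ∀ (i j : Fin 13) (c : ℝ), 0 ≤ c →
      (dist (pt i) (pt j) ≤ c ↔ (sqNormInt (T i - T j) : ℝ) ≤ (10000 * c) ^ 2) := by
    intro i j c hc
    rw [hdist, inv_mul_le_iff₀ (by norm_num : (0 : ℝ) < 10000),
      Real.sqrt_le_left (mul_nonneg (by norm_num) hc)]
  have hge : ∀ (i j : Fin 13) (c : ℝ), 0 ≤ c →
      (c ≤ dist (pt i) (pt j) ↔ (10000 * c) ^ 2 ≤ (sqNormInt (T i - T j) : ℝ)) := by
    intro i j c hc
    rw [hdist, le_inv_mul_iff₀ (by norm_num : (0 : ℝ) < 10000),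
      Real.le_sqrt (mul_nonneg (by norm_num) hc) (hnn _)]
  have hle1 : ∀ i j, dist (pt i) (pt j) ≤ 1 * (1 + 13 / 500) ↔ sqNormInt (T i - T j) ≤ 105267600 := by
    intro i j
    rw [hle i j _ (by norm_num), show ((10000 : ℝ) * (1 * (1 + 13 / 500))) ^ 2 =
      ((105267600 : ℤ) : ℝ) by norm_num, Int.cast_le]
  have hge1 : ∀ i j, 1 * (1 - 13 / 500) ≤ dist (pt i) (pt j) ↔ 94867600 ≤ sqNormInt (T i - T j) := by
    intro i j
    rw [hge i j _ (by norm_num), show ((10000 : ℝ) * (1 * (1 - 13 / 500))) ^ 2 =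
      ((94867600 : ℤ) : ℝ) by norm_num, Int.cast_le]
  have hge2 : ∀ i j, 1 * (63 / 50) ≤ dist (pt i) (pt j) ↔ 158760000 ≤ sqNormInt (T i - T j) := by
    intro i j
    rw [hge i j _ (by norm_num), show ((10000 : ℝ) * (1 * (63 / 50))) ^ 2 =
      ((158760000 : ℤ) : ℝ) by norm_num, Int.cast_le]
  have hpt_inj : ∀ i j, pt i = pt j → i = j := by
    intro i j h
    apply hinj
    rw [hpt, hpt] at h
    have h' : intVec (T i) = intVec (T j) :=
      (smul_right_injective (EuclideanSpace ℝ (Fin 3)) (by norm_num : (10000 : ℝ)⁻¹ ≠ 0)) h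
    have h'' : T i = T j := intVec_injective h'
    rw [h'', sub_self]
    simp [sqNormInt]
  -- pairwise band-or-far
  have hpair : ∀ p ∈ Set.range pt, ∀ q ∈ Set.range pt, q ≠ p → 1 * (1 - 13 / 500) ≤ dist p q ∧
      (dist p q ≤ 1 * (1 + 13 / 500) ∨ 1 * (63 / 50) ≤ dist p q) := by
    rintro p ⟨i, rfl⟩ q ⟨j, rfl⟩ hne
    have hji : j ≠ i := fun h => hne (by rw [h])
    obtain ⟨h1, h2⟩ := hsep i j hji
    refine ⟨(hge1 i j).2 h1, ?_⟩
    rcases h2 with h2 | h2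
    · exact Or.inl ((hle1 i j).2 h2)
    · exact Or.inr ((hge2 i j).2 h2)
  -- exactly twelve at the centre
  have htwelve : {w ∈ Set.range pt | w ≠ pt 0 ∧ dist (pt 0) w ≤ 1 * (1 + 13 / 500)}.ncard = 12 := by
    have hset : {w ∈ Set.range pt | w ≠ pt 0 ∧ dist (pt 0) w ≤ 1 * (1 + 13 / 500)} =
        ((Finset.univ.filter fun j : Fin 13 =>
            j ≠ 0 ∧ sqNormInt (T 0 - T j) ≤ 105267600).image pt : Set (EuclideanSpace ℝ (Fin 3))) := by
      ext w
      simp only [Set.mem_setOf_eq, Set.mem_range, Finset.coe_image, Set.mem_image,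
        Finset.mem_coe, Finset.mem_filter, Finset.mem_univ, true_and]
      constructor
      · rintro ⟨⟨j, rfl⟩, hne0, hd0⟩
        exact ⟨j, ⟨fun h => hne0 (by rw [h]), (hle1 0 j).1 hd0⟩, rfl⟩
      · rintro ⟨j, ⟨hj0, hd0⟩, rfl⟩
        exact ⟨⟨j, rfl⟩, fun h => hj0 (hpt_inj j 0 h), (hle1 0 j).2 hd0⟩
    rw [hset, Set.ncard_coe_finset, Finset.card_image_of_injective _ (fun a b h => hpt_inj a b h),
      htw]
  -- common-neighbour counts of the centre's bonds, as Finset cards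
  have hncard : ∀ j : Fin 13, {w ∈ Set.range pt | w ≠ pt 0 ∧ w ≠ pt j ∧
      dist (pt 0) w ≤ 1 * (1 + 13 / 500) ∧ dist (pt j) w ≤ 1 * (1 + 13 / 500)}.ncard =
        (Finset.univ.filter fun w : Fin 13 =>
          w ≠ 0 ∧ w ≠ j ∧ sqNormInt (T 0 - T w) ≤ 105267600 ∧ sqNormInt (T j - T w) ≤ 105267600).card := by
    intro j
    have hset : {w ∈ Set.range pt | w ≠ pt 0 ∧ w ≠ pt j ∧ dist (pt 0) w ≤ 1 * (1 + 13 / 500) ∧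
          dist (pt j) w ≤ 1 * (1 + 13 / 500)} =
        ((Finset.univ.filter fun w : Fin 13 =>
            w ≠ 0 ∧ w ≠ j ∧ sqNormInt (T 0 - T w) ≤ 105267600 ∧
              sqNormInt (T j - T w) ≤ 105267600).image pt : Set (EuclideanSpace ℝ (Fin 3))) := by
      ext w
      simp only [Set.mem_setOf_eq, Set.mem_range, Finset.coe_image, Set.mem_image,
        Finset.mem_coe, Finset.mem_filter, Finset.mem_univ, true_and]
      constructor
      · rintro ⟨⟨k, rfl⟩, hne0, hne1, hd0, hd1⟩
        exact ⟨k, ⟨fun h => hne0 (by rw [h]), fun h => hne1 (by rw [h]), (hle1 0 k).1 hd0,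
          (hle1 j k).1 hd1⟩, rfl⟩
      · rintro ⟨k, ⟨hk0, hk1, hd0, hd1⟩, rfl⟩
        exact ⟨⟨k, rfl⟩, fun h => hk0 (hpt_inj k 0 h), fun h => hk1 (hpt_inj k j h),
          (hle1 0 k).2 hd0, (hle1 j k).2 hd1⟩
    rw [hset, Set.ncard_coe_finset, Finset.card_image_of_injective _ (fun a b h => hpt_inj a b h)]
  -- torn-free at the centre
  have htornfree : ∀ v ∈ Set.range pt, v ≠ pt 0 → dist (pt 0) v ≤ 1 * (1 + 13 / 500) →
      4 ≤ {w ∈ Set.range pt | w ≠ pt 0 ∧ w ≠ v ∧ dist (pt 0) w ≤ 1 * (1 + 13 / 500) ∧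
        dist v w ≤ 1 * (1 + 13 / 500)}.ncard := by
    rintro v ⟨j, rfl⟩ hne hd
    rw [hncard j]
    exact htf j (fun h => hne (by rw [h])) ((hle1 0 j).1 hd)
  have h2 := h (Set.range pt) 1 one_pos hpair (pt 0) ⟨0, rfl⟩ htwelve htornfree
  have hset : {v ∈ Set.range pt | v ≠ pt 0 ∧ dist (pt 0) v ≤ 1 * (1 + 13 / 500) ∧
      5 ≤ {w ∈ Set.range pt | w ≠ pt 0 ∧ w ≠ v ∧ dist (pt 0) w ≤ 1 * (1 + 13 / 500) ∧
        dist v w ≤ 1 * (1 + 13 / 500)}.ncard} =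
      ((Finset.univ.filter fun v : Fin 13 => v ≠ 0 ∧ sqNormInt (T 0 - T v) ≤ 105267600 ∧
          5 ≤ (Finset.univ.filter fun w : Fin 13 =>
            w ≠ 0 ∧ w ≠ v ∧ sqNormInt (T 0 - T w) ≤ 105267600 ∧
              sqNormInt (T v - T w) ≤ 105267600).card).image pt : Set (EuclideanSpace ℝ (Fin 3))) := by
    ext v
    refine ⟨fun hv => ?_, fun hv => ?_⟩
    · obtain ⟨⟨j, rfl⟩, hne, hd, h5⟩ := hv
      rw [hncard j] at h5
      exact Finset.mem_coe.2 (Finset.mem_image.2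
        ⟨j, Finset.mem_filter.2 ⟨Finset.mem_univ _, fun h => hne (by rw [h]), (hle1 0 j).1 hd, h5⟩, rfl⟩)
    · obtain ⟨j, hj, rfl⟩ := Finset.mem_image.1 (Finset.mem_coe.1 hv)
      obtain ⟨-, hj0, hd, h5⟩ := Finset.mem_filter.1 hj
      refine ⟨⟨j, rfl⟩, fun h => hj0 (hpt_inj j 0 h), (hle1 0 j).2 hd, ?_⟩
      rw [hncard j]
      exact h5
  rw [hset, Set.ncard_coe_finset, Finset.card_image_of_injective _ (fun a b h => hpt_inj a b h),
    hcap] at h2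
  omega

/-- **(CS) fails at `3/100`.** In `Y = OpenPairShell / 10⁴` (scale `a = 1`, tolerance `3/100`) all
pairs are in `[97/100, 103/100] ∪ [63/50, ∞)`, the centre `Y₀` has exactly twelve neighbours with shell
degrees `≥ 4` (torn-free at `Y₀`), the bond `(Y₀, Y₁)` has exactly five common neighbours
`Y₂, Y₃, Y₄, Y₅, Y₁₂`, and `Y₂` is bonded to only ONE of the other four (`Y₄`): the star of the capped
bond is the open `4T+Q` (ring word (4,1)).  The second pole `Y₅` is ADJACENT to `Y₁` (`64°`), so the same
witness also kills the antipodality clause of (NB) at `3 %`. [folklore] -/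
theorem closedStarOneShellAt_false : ¬ ClosedStarOneShellAt (3 / 100) := by
  intro h
  obtain ⟨T, hinj, hsep, htw, htf, h01, hcommon, h02, h12, hdeg⟩ :
      ∃ T : Fin 13 → Fin 3 → ℤ,
        (∀ i j : Fin 13, sqNormInt (T i - T j) = 0 → i = j) ∧
        (∀ i j : Fin 13, j ≠ i → 94090000 ≤ sqNormInt (T i - T j) ∧
            (sqNormInt (T i - T j) ≤ 106090000 ∨ 158760000 ≤ sqNormInt (T i - T j))) ∧
        (Finset.univ.filter fun j : Fin 13 => j ≠ 0 ∧ sqNormInt (T 0 - T j) ≤ 106090000).card = 12 ∧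
        (∀ v : Fin 13, v ≠ 0 → sqNormInt (T 0 - T v) ≤ 106090000 →
          4 ≤ (Finset.univ.filter fun w : Fin 13 =>
            w ≠ 0 ∧ w ≠ v ∧ sqNormInt (T 0 - T w) ≤ 106090000 ∧
              sqNormInt (T v - T w) ≤ 106090000).card) ∧
        sqNormInt (T 0 - T 1) ≤ 106090000 ∧
        (Finset.univ.filter fun w : Fin 13 =>
            w ≠ 0 ∧ w ≠ 1 ∧ sqNormInt (T 0 - T w) ≤ 106090000 ∧
              sqNormInt (T 1 - T w) ≤ 106090000).card = 5 ∧
        sqNormInt (T 0 - T 2) ≤ 106090000 ∧ sqNormInt (T 1 - T 2) ≤ 106090000 ∧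
        (Finset.univ.filter fun w : Fin 13 =>
            w ≠ 0 ∧ w ≠ 1 ∧ w ≠ 2 ∧ sqNormInt (T 0 - T w) ≤ 106090000 ∧
              sqNormInt (T 1 - T w) ≤ 106090000 ∧ sqNormInt (T 2 - T w) ≤ 106090000).card = 1 :=
    ⟨OpenPairShell, by decide, by decide, by decide, by decide, by decide, by decide, by decide,
      by decide, by decide⟩
  have h10 : (1 : Fin 13) ≠ 0 := by decide
  have h20 : (2 : Fin 13) ≠ 0 := by decide
  have h21 : (2 : Fin 13) ≠ 1 := by decide
  obtain ⟨pt, hpt⟩ : ∃ pt : Fin 13 → EuclideanSpace ℝ (Fin 3),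
      ∀ i, pt i = (10000 : ℝ)⁻¹ • intVec (T i) := ⟨_, fun _ => rfl⟩
  have hnn : ∀ v : Fin 3 → ℤ, (0 : ℝ) ≤ (sqNormInt v : ℝ) := by
    intro v
    have h : (0 : ℤ) ≤ sqNormInt v := by unfold sqNormInt; positivity
    exact_mod_cast h
  have hdist : ∀ i j, dist (pt i) (pt j) = (10000 : ℝ)⁻¹ * Real.sqrt (sqNormInt (T i - T j) : ℝ) := by
    intro i j
    rw [hpt, hpt, dist_eq_norm, ← smul_sub, intVec_sub, norm_smul, norm_inv,
      Real.norm_of_nonneg (by norm_num : (0 : ℝ) ≤ 10000), norm_intVec]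
  have hle : ∀ (i j : Fin 13) (c : ℝ), 0 ≤ c →
      (dist (pt i) (pt j) ≤ c ↔ (sqNormInt (T i - T j) : ℝ) ≤ (10000 * c) ^ 2) := by
    intro i j c hc
    rw [hdist, inv_mul_le_iff₀ (by norm_num : (0 : ℝ) < 10000),
      Real.sqrt_le_left (mul_nonneg (by norm_num) hc)]
  have hge : ∀ (i j : Fin 13) (c : ℝ), 0 ≤ c →
      (c ≤ dist (pt i) (pt j) ↔ (10000 * c) ^ 2 ≤ (sqNormInt (T i - T j) : ℝ)) := by
    intro i j c hc
    rw [hdist, le_inv_mul_iff₀ (by norm_num : (0 : ℝ) < 10000),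
      Real.le_sqrt (mul_nonneg (by norm_num) hc) (hnn _)]
  have hle1 : ∀ i j, dist (pt i) (pt j) ≤ 1 * (1 + 3 / 100) ↔ sqNormInt (T i - T j) ≤ 106090000 := by
    intro i j
    rw [hle i j _ (by norm_num), show ((10000 : ℝ) * (1 * (1 + 3 / 100))) ^ 2 =
      ((106090000 : ℤ) : ℝ) by norm_num, Int.cast_le]
  have hge1 : ∀ i j, 1 * (1 - 3 / 100) ≤ dist (pt i) (pt j) ↔ 94090000 ≤ sqNormInt (T i - T j) := by
    intro i j
    rw [hge i j _ (by norm_num), show ((10000 : ℝ) * (1 * (1 - 3 / 100))) ^ 2 =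
      ((94090000 : ℤ) : ℝ) by norm_num, Int.cast_le]
  have hge2 : ∀ i j, 1 * (63 / 50) ≤ dist (pt i) (pt j) ↔ 158760000 ≤ sqNormInt (T i - T j) := by
    intro i j
    rw [hge i j _ (by norm_num), show ((10000 : ℝ) * (1 * (63 / 50))) ^ 2 =
      ((158760000 : ℤ) : ℝ) by norm_num, Int.cast_le]
  have hpt_inj : ∀ i j, pt i = pt j → i = j := by
    intro i j h
    apply hinj
    rw [hpt, hpt] at h
    have h' : intVec (T i) = intVec (T j) :=
      (smul_right_injective (EuclideanSpace ℝ (Fin 3)) (by norm_num : (10000 : ℝ)⁻¹ ≠ 0)) h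
    have h'' : T i = T j := intVec_injective h'
    rw [h'', sub_self]
    simp [sqNormInt]
  -- pairwise band-or-far
  have hpair : ∀ p ∈ Set.range pt, ∀ q ∈ Set.range pt, q ≠ p → 1 * (1 - 3 / 100) ≤ dist p q ∧
      (dist p q ≤ 1 * (1 + 3 / 100) ∨ 1 * (63 / 50) ≤ dist p q) := by
    rintro p ⟨i, rfl⟩ q ⟨j, rfl⟩ hne
    have hji : j ≠ i := fun h => hne (by rw [h])
    obtain ⟨h1, h2⟩ := hsep i j hji
    refine ⟨(hge1 i j).2 h1, ?_⟩
    rcases h2 with h2 | h2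
    · exact Or.inl ((hle1 i j).2 h2)
    · exact Or.inr ((hge2 i j).2 h2)
  -- exactly twelve at the centre
  have htwelve : {w ∈ Set.range pt | w ≠ pt 0 ∧ dist (pt 0) w ≤ 1 * (1 + 3 / 100)}.ncard = 12 := by
    have hset : {w ∈ Set.range pt | w ≠ pt 0 ∧ dist (pt 0) w ≤ 1 * (1 + 3 / 100)} =
        ((Finset.univ.filter fun j : Fin 13 =>
            j ≠ 0 ∧ sqNormInt (T 0 - T j) ≤ 106090000).image pt : Set (EuclideanSpace ℝ (Fin 3))) := by
      ext w
      simp only [Set.mem_setOf_eq, Set.mem_range, Finset.coe_image, Set.mem_image,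
        Finset.mem_coe, Finset.mem_filter, Finset.mem_univ, true_and]
      constructor
      · rintro ⟨⟨j, rfl⟩, hne0, hd0⟩
        exact ⟨j, ⟨fun h => hne0 (by rw [h]), (hle1 0 j).1 hd0⟩, rfl⟩
      · rintro ⟨j, ⟨hj0, hd0⟩, rfl⟩
        exact ⟨⟨j, rfl⟩, fun h => hj0 (hpt_inj j 0 h), (hle1 0 j).2 hd0⟩
    rw [hset, Set.ncard_coe_finset, Finset.card_image_of_injective _ (fun a b h => hpt_inj a b h),
      htw]
  -- common-neighbour counts of the centre's bonds, as Finset cards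
  have hncard : ∀ j : Fin 13, {w ∈ Set.range pt | w ≠ pt 0 ∧ w ≠ pt j ∧
      dist (pt 0) w ≤ 1 * (1 + 3 / 100) ∧ dist (pt j) w ≤ 1 * (1 + 3 / 100)}.ncard =
        (Finset.univ.filter fun w : Fin 13 =>
          w ≠ 0 ∧ w ≠ j ∧ sqNormInt (T 0 - T w) ≤ 106090000 ∧ sqNormInt (T j - T w) ≤ 106090000).card := by
    intro j
    have hset : {w ∈ Set.range pt | w ≠ pt 0 ∧ w ≠ pt j ∧ dist (pt 0) w ≤ 1 * (1 + 3 / 100) ∧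
          dist (pt j) w ≤ 1 * (1 + 3 / 100)} =
        ((Finset.univ.filter fun w : Fin 13 =>
            w ≠ 0 ∧ w ≠ j ∧ sqNormInt (T 0 - T w) ≤ 106090000 ∧
              sqNormInt (T j - T w) ≤ 106090000).image pt : Set (EuclideanSpace ℝ (Fin 3))) := by
      ext w
      simp only [Set.mem_setOf_eq, Set.mem_range, Finset.coe_image, Set.mem_image,
        Finset.mem_coe, Finset.mem_filter, Finset.mem_univ, true_and]
      constructor
      · rintro ⟨⟨k, rfl⟩, hne0, hne1, hd0, hd1⟩
        exact ⟨k, ⟨fun h => hne0 (by rw [h]), fun h => hne1 (by rw [h]), (hle1 0 k).1 hd0,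
          (hle1 j k).1 hd1⟩, rfl⟩
      · rintro ⟨k, ⟨hk0, hk1, hd0, hd1⟩, rfl⟩
        exact ⟨⟨k, rfl⟩, fun h => hk0 (hpt_inj k 0 h), fun h => hk1 (hpt_inj k j h),
          (hle1 0 k).2 hd0, (hle1 j k).2 hd1⟩
    rw [hset, Set.ncard_coe_finset, Finset.card_image_of_injective _ (fun a b h => hpt_inj a b h)]
  -- torn-free at the centre
  have htornfree : ∀ v ∈ Set.range pt, v ≠ pt 0 → dist (pt 0) v ≤ 1 * (1 + 3 / 100) →
      4 ≤ {w ∈ Set.range pt | w ≠ pt 0 ∧ w ≠ v ∧ dist (pt 0) w ≤ 1 * (1 + 3 / 100) ∧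
        dist v w ≤ 1 * (1 + 3 / 100)}.ncard := by
    rintro v ⟨j, rfl⟩ hne hd
    rw [hncard j]
    exact htf j (fun h => hne (by rw [h])) ((hle1 0 j).1 hd)
  have hcap5 : 5 ≤ {w ∈ Set.range pt | w ≠ pt 0 ∧ w ≠ pt 1 ∧ dist (pt 0) w ≤ 1 * (1 + 3 / 100) ∧
      dist (pt 1) w ≤ 1 * (1 + 3 / 100)}.ncard := by
    rw [hncard 1, hcommon]
  have h4 := h (Set.range pt) 1 one_pos hpair (pt 0) ⟨0, rfl⟩ htwelve htornfree (pt 1) ⟨1, rfl⟩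
    (fun h => h10 (hpt_inj 1 0 h)) ((hle1 0 1).2 h01) hcap5 (pt 2) ⟨2, rfl⟩
    (fun h => h20 (hpt_inj 2 0 h)) (fun h => h21 (hpt_inj 2 1 h)) ((hle1 0 2).2 h02) ((hle1 1 2).2 h12)
  have hset : {w' ∈ Set.range pt | w' ≠ pt 0 ∧ w' ≠ pt 1 ∧ w' ≠ pt 2 ∧
        dist (pt 0) w' ≤ 1 * (1 + 3 / 100) ∧ dist (pt 1) w' ≤ 1 * (1 + 3 / 100) ∧
          dist (pt 2) w' ≤ 1 * (1 + 3 / 100)} =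
      ((Finset.univ.filter fun j : Fin 13 =>
          j ≠ 0 ∧ j ≠ 1 ∧ j ≠ 2 ∧ sqNormInt (T 0 - T j) ≤ 106090000 ∧
            sqNormInt (T 1 - T j) ≤ 106090000 ∧ sqNormInt (T 2 - T j) ≤ 106090000).image pt :
        Set (EuclideanSpace ℝ (Fin 3))) := by
    ext w
    simp only [Set.mem_setOf_eq, Set.mem_range, Finset.coe_image, Set.mem_image,
      Finset.mem_coe, Finset.mem_filter, Finset.mem_univ, true_and]
    constructor
    · rintro ⟨⟨j, rfl⟩, hne0, hne1, hne2, hd0, hd1, hd2⟩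
      exact ⟨j, ⟨fun h => hne0 (by rw [h]), fun h => hne1 (by rw [h]), fun h => hne2 (by rw [h]),
        (hle1 0 j).1 hd0, (hle1 1 j).1 hd1, (hle1 2 j).1 hd2⟩, rfl⟩
    · rintro ⟨j, ⟨hj0, hj1, hj2, hd0, hd1, hd2⟩, rfl⟩
      exact ⟨⟨j, rfl⟩, fun h => hj0 (hpt_inj j 0 h), fun h => hj1 (hpt_inj j 1 h),
        fun h => hj2 (hpt_inj j 2 h), (hle1 0 j).2 hd0, (hle1 1 j).2 hd1, (hle1 2 j).2 hd2⟩
  rw [hset, Set.ncard_coe_finset, Finset.card_image_of_injective _ (fun a b h => hpt_inj a b h),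
    hdeg] at h4
  omega

end Summit.AtomisticToContinuum.Crystallization.Theorems.FiveFoldRationingR.Negative

end
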